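import Literature.RingTheory.MvPolynomial.OstrowskiNorms
import Mathlib.Analysis.Normed.Unbundled.RingSeminorm
import Mathlib.RingTheory.MvPolynomial.WeightedHomogeneous
import Mathlib.Algebra.Polynomial.BigOperators
import Mathlib.Algebra.Polynomial.Div
import Mathlib.LinearAlgebra.Matrix.Determinant.Basic
import HarnessLib

/-!
# Toolkit for effective Noether forms: weighted `ℓ¹` norms and graded bookkeeping on nested
# polynomial rings

Support file for the proof of Kaltofen's Theorem 7 (`kaltofen1995_thm7`, effective Noether
irreducibility forms; E. Kaltofen, *Effective Noether irreducibility forms and applications*,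
J. Comput. System Sci. 50 (1995) 274–295, §3 and §5). Kaltofen's §3 ("Coefficient Growth
Analysis") bounds the DEGREES in the generic coefficients and the `1`-NORMS of every intermediate
polynomial of his algorithm run on a generic input. This file provides the two bookkeeping devices
we use for the same purpose in our (differently organised) proof:

* `polyNorm p t P = Σᵢ p(Pᵢ) tⁱ`, the `t`-weighted `ℓ¹` extension to `R[X]` of a ring seminorm `p`
  on `R` (`t ≥ 0`); it is again subadditive and submultiplicative (`polyNorm_add_le`,
  `polyNorm_mul_le`) — Kaltofen's "useful properties of this norm" `‖φψ‖₁ ≤ ‖φ‖₁‖ψ‖₁`,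
  `‖φ + ψ‖₁ ≤ ‖φ‖₁ + ‖ψ‖₁` (§3, p. 10) — and dominates each weighted coefficient
  (`le_polyNorm`). With `t < 1` it is the majorant device that replaces Kaltofen's Catalan-number
  induction (proof of his Thm. 1) in our norm estimates. Schmidt's/Kaltofen's norm `l1Norm` on
  `ℤ[σ]` is packaged as the ring seminorm `l1Seminorm`.
* graded predicates `ZHom w P W` ("the `zᶥ`-coefficient of `P ∈ ℤ[σ][z]` is weighted homogeneous
  of weight `W - ι`") and `YZHom w s P W` (the same for `P ∈ ℤ[σ][z][y]` with `y` of weight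
  `-s`), closed under ring operations, and the corresponding homogeneity of determinants
  (`ZHom.det`) — the isobaric bookkeeping behind "deg_{c's}" in Kaltofen §3.
* small helpers: coefficientwise application of a linear map (`mapCoeffs`), truncation
  (`truncY`), degree and norm of a determinant (`natDegree_det_le_of_le`, `polyNorm_det_le`).

Everything here is [folklore]; no cited statements.

## References

* E. Kaltofen, J. Comput. System Sci. 50 (1995) 274–295, §3. [`Kaltofen1995`]
-/

noncomputable section

open Polynomial

namespace Literature.RingTheory.MvPolynomial.NoetherForms

/-! ### The weighted `ℓ¹` extension of a ring seminorm to `R[X]` -/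

section PolyNorm

variable {R : Type*} [CommRing R]

/-- `polyNorm p t P = Σᵢ p(coeff P i) · tⁱ`: the `t`-weighted `ℓ¹`-extension of the ring seminorm
`p` to polynomials. [folklore] -/
def polyNorm (p : RingSeminorm R) (t : ℝ) (P : R[X]) : ℝ :=
  ∑ i ∈ P.support, p (P.coeff i) * t ^ i

variable (p : RingSeminorm R) {t : ℝ}

/-- The defining sum may be taken over any finite set containing the support. [folklore] -/
theorem polyNorm_eq_sum_of_subset (t : ℝ) {P : R[X]} {s : Finset ℕ} (h : P.support ⊆ s) :
    polyNorm p t P = ∑ i ∈ s, p (P.coeff i) * t ^ i := by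
  unfold polyNorm
  refine Finset.sum_subset h fun i _ hi => ?_
  rw [Polynomial.notMem_support_iff.mp hi, map_zero, zero_mul]

/-- `polyNorm` is non-negative for `t ≥ 0`. [folklore] -/
theorem polyNorm_nonneg (ht : 0 ≤ t) (P : R[X]) : 0 ≤ polyNorm p t P :=
  Finset.sum_nonneg fun i _ => mul_nonneg (apply_nonneg p _) (pow_nonneg ht i)

/-- `polyNorm` of `0`. [folklore] -/
@[simp] theorem polyNorm_zero (t : ℝ) : polyNorm p t (0 : R[X]) = 0 := by
  simp [polyNorm]

/-- `polyNorm` of a monomial. [folklore] -/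
@[simp] theorem polyNorm_monomial (t : ℝ) (n : ℕ) (a : R) :
    polyNorm p t (monomial n a) = p a * t ^ n := by
  classical
  unfold polyNorm
  by_cases ha : a = 0
  · subst ha
    simp
  · rw [Polynomial.support_monomial n ha, Finset.sum_singleton, Polynomial.coeff_monomial,
      if_pos rfl]

/-- `polyNorm` of a constant. [folklore] -/
@[simp] theorem polyNorm_C (t : ℝ) (a : R) : polyNorm p t (C a) = p a := by
  rw [← monomial_zero_left, polyNorm_monomial, pow_zero, mul_one]

/-- `polyNorm (-P) = polyNorm P`. [folklore] -/
@[simp] theorem polyNorm_neg (t : ℝ) (P : R[X]) : polyNorm p t (-P) = polyNorm p t P := by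
  unfold polyNorm
  rw [Polynomial.support_neg]
  exact Finset.sum_congr rfl fun i _ => by rw [coeff_neg, map_neg_eq_map]

/-- Subadditivity of `polyNorm`. [folklore] -/
theorem polyNorm_add_le (ht : 0 ≤ t) (P Q : R[X]) :
    polyNorm p t (P + Q) ≤ polyNorm p t P + polyNorm p t Q := by
  classical
  rw [polyNorm_eq_sum_of_subset p t (Polynomial.support_add (p := P) (q := Q)),
    polyNorm_eq_sum_of_subset p t (Finset.subset_union_left (s₁ := P.support) (s₂ := Q.support)),
    polyNorm_eq_sum_of_subset p t (Finset.subset_union_right (s₁ := P.support) (s₂ := Q.support)),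
    ← Finset.sum_add_distrib]
  refine Finset.sum_le_sum fun i _ => ?_
  rw [coeff_add, ← add_mul]
  exact mul_le_mul_of_nonneg_right (map_add_le_add p _ _) (pow_nonneg ht i)

/-- `polyNorm` of a finite sum. [folklore] -/
theorem polyNorm_sum_le (ht : 0 ≤ t) {ι : Type*} (s : Finset ι) (f : ι → R[X]) :
    polyNorm p t (∑ i ∈ s, f i) ≤ ∑ i ∈ s, polyNorm p t (f i) := by
  classical
  induction s using Finset.induction_on with
  | empty => simp
  | insert a s ha ih =>
    rw [Finset.sum_insert ha, Finset.sum_insert ha]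
    exact (polyNorm_add_le p ht _ _).trans (by linarith)

/-- Submultiplicativity of `polyNorm` (Kaltofen §3: `‖φψ‖₁ ≤ ‖φ‖₁‖ψ‖₁`). [folklore] -/
theorem polyNorm_mul_le (ht : 0 ≤ t) (P Q : R[X]) :
    polyNorm p t (P * Q) ≤ polyNorm p t P * polyNorm p t Q := by
  classical
  have hPQ : P * Q = ∑ i ∈ P.support, ∑ j ∈ Q.support, monomial (i + j) (P.coeff i * Q.coeff j) := by
    conv_lhs => rw [P.as_sum_support, Q.as_sum_support]
    rw [Finset.sum_mul]
    refine Finset.sum_congr rfl fun i _ => ?_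
    rw [Finset.mul_sum]
    refine Finset.sum_congr rfl fun j _ => ?_
    rw [monomial_mul_monomial]
  calc polyNorm p t (P * Q)
        = polyNorm p t (∑ i ∈ P.support, ∑ j ∈ Q.support,
            monomial (i + j) (P.coeff i * Q.coeff j)) := by rw [hPQ]
    _ ≤ ∑ i ∈ P.support, polyNorm p t (∑ j ∈ Q.support,
            monomial (i + j) (P.coeff i * Q.coeff j)) := polyNorm_sum_le p ht _ _
    _ ≤ ∑ i ∈ P.support, ∑ j ∈ Q.support, (p (P.coeff i) * t ^ i) * (p (Q.coeff j) * t ^ j) := by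
        refine Finset.sum_le_sum fun i _ => (polyNorm_sum_le p ht _ _).trans ?_
        refine Finset.sum_le_sum fun j _ => ?_
        rw [polyNorm_monomial, pow_add, mul_mul_mul_comm]
        exact mul_le_mul_of_nonneg_right (map_mul_le_mul p _ _)
          (mul_nonneg (pow_nonneg ht i) (pow_nonneg ht j))
    _ = polyNorm p t P * polyNorm p t Q := by
        rw [polyNorm, polyNorm, Finset.sum_mul_sum]

/-- The weighted `ℓ¹` extension as a ring seminorm on `R[X]` (`t ≥ 0`); a deliberate dot-notation
extension of Mathlib's `RingSeminorm`. [folklore] -/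
def _root_.RingSeminorm.polynomial (p : RingSeminorm R) (t : ℝ) (ht : 0 ≤ t) :
    RingSeminorm R[X] where
  toFun := polyNorm p t
  map_zero' := polyNorm_zero p t
  add_le' := polyNorm_add_le p ht
  neg' := polyNorm_neg p t
  mul_le' := polyNorm_mul_le p ht

/-- Unfolding the seminorm (dot-notation extension of Mathlib's `RingSeminorm`). [folklore] -/
@[simp] theorem _root_.RingSeminorm.polynomial_apply (t : ℝ) (ht : 0 ≤ t) (P : R[X]) :
    p.polynomial t ht P = polyNorm p t P := rfl

/-- Each weighted coefficient is dominated by the weighted norm. [folklore] -/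
theorem le_polyNorm (ht : 0 ≤ t) (P : R[X]) (i : ℕ) : p (P.coeff i) * t ^ i ≤ polyNorm p t P := by
  classical
  by_cases hi : i ∈ P.support
  · exact Finset.single_le_sum (f := fun i => p (P.coeff i) * t ^ i)
      (fun j _ => mul_nonneg (apply_nonneg p _) (pow_nonneg ht j)) hi
  · rw [Polynomial.notMem_support_iff.mp hi, map_zero, zero_mul]
    exact polyNorm_nonneg p ht P

/-- `polyNorm 1 = p 1`. [folklore] -/
@[simp] theorem polyNorm_one (t : ℝ) : polyNorm p t (1 : R[X]) = p 1 := by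
  rw [← C_1, polyNorm_C]

/-- Powers: `polyNorm (Pⁿ) ≤ (polyNorm P)ⁿ` when `p 1 ≤ 1`. [folklore] -/
theorem polyNorm_pow_le (ht : 0 ≤ t) (h1 : p 1 ≤ 1) (P : R[X]) (n : ℕ) :
    polyNorm p t (P ^ n) ≤ polyNorm p t P ^ n := by
  induction n with
  | zero => simpa using h1
  | succ n ih =>
    rw [pow_succ, pow_succ]
    exact (polyNorm_mul_le p ht _ _).trans
      (mul_le_mul_of_nonneg_right ih (polyNorm_nonneg p ht P))

/-- Products: `polyNorm (∏ fᵢ) ≤ ∏ polyNorm fᵢ` when `p 1 ≤ 1`. [folklore] -/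
theorem polyNorm_prod_le (ht : 0 ≤ t) (h1 : p 1 ≤ 1) {ι : Type*} (s : Finset ι) (f : ι → R[X]) :
    polyNorm p t (∏ i ∈ s, f i) ≤ ∏ i ∈ s, polyNorm p t (f i) := by
  classical
  induction s using Finset.induction_on with
  | empty => simpa using h1
  | insert a s ha ih =>
    rw [Finset.prod_insert ha, Finset.prod_insert ha]
    exact (polyNorm_mul_le p ht _ _).trans
      (mul_le_mul_of_nonneg_left ih (polyNorm_nonneg p ht _))

/-- Monotonicity in the weight: for `0 ≤ t ≤ t'`, `polyNorm p t P ≤ polyNorm p t' P`. [folklore] -/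
theorem polyNorm_mono_weight {t t' : ℝ} (ht : 0 ≤ t) (htt' : t ≤ t') (P : R[X]) :
    polyNorm p t P ≤ polyNorm p t' P :=
  Finset.sum_le_sum fun i _ =>
    mul_le_mul_of_nonneg_left (pow_le_pow_left₀ ht htt' i) (apply_nonneg p _)

end PolyNorm

/-! ### Schmidt's / Kaltofen's `1`-norm on `ℤ[σ]` as a ring seminorm -/

section L1

variable {σ : Type*}

/-- `l1Norm` (sum of the absolute values of the coefficients) as a ring seminorm on `ℤ[σ]`,
real-valued. [folklore] -/
def l1Seminorm (σ : Type*) : RingSeminorm (MvPolynomial σ ℤ) where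
  toFun f := (l1Norm f : ℝ)
  map_zero' := by simp
  add_le' f g := by exact_mod_cast l1Norm_add_le f g
  neg' f := by rw [l1Norm_neg]
  mul_le' f g := by exact_mod_cast l1Norm_mul_le f g

/-- Unfolding `l1Seminorm`. [folklore] -/
@[simp] theorem l1Seminorm_apply (f : MvPolynomial σ ℤ) : l1Seminorm σ f = (l1Norm f : ℝ) := rfl

/-- `‖1‖ = 1`. [folklore] -/
theorem l1Seminorm_one : l1Seminorm σ 1 = 1 := by simp

end L1

/-! ### Coefficientwise operations on `S[X]` -/

section Coeffwise

variable {A S : Type*} [CommRing A] [CommRing S] [Algebra A S]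

/-- Apply an `A`-linear map to every coefficient of a polynomial over the `A`-algebra `S`.
[folklore] -/
def mapCoeffs (L : S →ₗ[A] S) : S[X] →ₗ[A] S[X] :=
  Polynomial.lsum fun n => (monomial n).restrictScalars A ∘ₗ L

/-- Coefficients of `mapCoeffs L P`. [folklore] -/
@[simp] theorem coeff_mapCoeffs (L : S →ₗ[A] S) (P : S[X]) (n : ℕ) :
    (mapCoeffs L P).coeff n = L (P.coeff n) := by
  classical
  rw [mapCoeffs, Polynomial.lsum_apply, Polynomial.sum_def, Polynomial.finsetSum_coeff]
  simp only [LinearMap.coe_comp, LinearMap.coe_restrictScalars, Function.comp_apply,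
    Polynomial.coeff_monomial]
  rw [Finset.sum_ite_eq']
  split_ifs with h
  · rfl
  · rw [Polynomial.notMem_support_iff.mp h, map_zero]

/-- Truncation below `X^m`: `Σ_{i<m} coeff P i · Xⁱ`. [folklore] -/
def truncY (m : ℕ) (P : S[X]) : S[X] :=
  ∑ i ∈ Finset.range m, monomial i (P.coeff i)

/-- Coefficients of the truncation. [folklore] -/
theorem coeff_truncY (m : ℕ) (P : S[X]) (n : ℕ) :
    (truncY m P).coeff n = if n < m then P.coeff n else 0 := by
  rw [truncY, Polynomial.finsetSum_coeff]
  simp only [Polynomial.coeff_monomial]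
  rw [Finset.sum_ite_eq' (Finset.range m) n (fun i => P.coeff i)]
  simp only [Finset.mem_range]

/-- `P ≡ truncY m P (mod X^m)`. [folklore] -/
theorem X_pow_dvd_sub_truncY (m : ℕ) (P : S[X]) : X ^ m ∣ P - truncY m P := by
  rw [Polynomial.X_pow_dvd_iff]
  intro n hn
  rw [coeff_sub, coeff_truncY, if_pos hn, sub_self]

/-- The constant term of a truncation (`m ≥ 1`) is that of `P`. [folklore] -/
theorem coeff_zero_truncY_succ (m : ℕ) (P : S[X]) : (truncY (m + 1) P).coeff 0 = P.coeff 0 := by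
  rw [coeff_truncY, if_pos (Nat.succ_pos m)]

/-- Truncation does not increase the weighted norm. [folklore] -/
theorem polyNorm_truncY_le (p : RingSeminorm S) {t : ℝ} (ht : 0 ≤ t) (m : ℕ) (P : S[X]) :
    polyNorm p t (truncY m P) ≤ polyNorm p t P := by
  classical
  unfold truncY
  refine (polyNorm_sum_le p ht _ _).trans ?_
  calc ∑ i ∈ Finset.range m, polyNorm p t (monomial i (P.coeff i))
        = ∑ i ∈ Finset.range m, p (P.coeff i) * t ^ i :=
          Finset.sum_congr rfl fun i _ => polyNorm_monomial p t i _
    _ = ∑ i ∈ Finset.range m ∩ P.support, p (P.coeff i) * t ^ i := by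
          refine (Finset.sum_subset Finset.inter_subset_left fun i hi hni => ?_).symm
          have hi' : i ∉ P.support := fun h => hni (Finset.mem_inter.mpr ⟨hi, h⟩)
          rw [Polynomial.notMem_support_iff.mp hi', map_zero, zero_mul]
    _ ≤ ∑ i ∈ P.support, p (P.coeff i) * t ^ i :=
          Finset.sum_le_sum_of_subset_of_nonneg Finset.inter_subset_right
            fun i _ _ => mul_nonneg (apply_nonneg p _) (pow_nonneg ht i)
    _ = polyNorm p t P := rfl

/-- A coefficientwise map with `p (L a) ≤ c · p a` multiplies the weighted norm by at most `c`.
[folklore] -/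
theorem polyNorm_mapCoeffs_le (p : RingSeminorm S) {t : ℝ} (ht : 0 ≤ t) (L : S →ₗ[A] S) {c : ℝ}
    (P : S[X]) (hL : ∀ i, p (L (P.coeff i)) ≤ c * p (P.coeff i)) :
    polyNorm p t (mapCoeffs L P) ≤ c * polyNorm p t P := by
  classical
  have hsupp : (mapCoeffs L P).support ⊆ P.support := by
    intro i hi
    rw [Polynomial.mem_support_iff] at hi ⊢
    intro h
    exact hi (by rw [coeff_mapCoeffs, h, map_zero])
  rw [polyNorm_eq_sum_of_subset p t hsupp, polyNorm, Finset.mul_sum]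
  refine Finset.sum_le_sum fun i _ => ?_
  rw [coeff_mapCoeffs, ← mul_assoc]
  exact mul_le_mul_of_nonneg_right (hL i) (pow_nonneg ht i)

end Coeffwise

/-! ### Graded bookkeeping: `z`-graded and `(y, z)`-graded weighted homogeneity -/

section Graded

open _root_.MvPolynomial

variable {σ : Type*} {R : Type*} [CommRing R]

/-- `ZHom w P W`: the `zᶥ`-coefficient of `P ∈ R[σ][z]` is weighted homogeneous (weights `w`,
values in `ℤ`) of weight `W - ι`; i.e. `P` is weighted homogeneous of weight `W` when `z` is given
weight `1`. [folklore] -/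
def ZHom (w : σ → ℤ) (P : Polynomial (MvPolynomial σ R)) (W : ℤ) : Prop :=
  ∀ ι : ℕ, IsWeightedHomogeneous w (P.coeff ι) (W - ι)

/-- `YZHom w s P W`: every `yᵐ`-coefficient of `P ∈ R[σ][z][y]` satisfies `ZHom w · (W + s m)`;
i.e. `P` is weighted homogeneous of weight `W` when `z ↦ 1`, `y ↦ -s`. [folklore] -/
def YZHom (w : σ → ℤ) (s : ℤ) (P : Polynomial (Polynomial (MvPolynomial σ R))) (W : ℤ) : Prop :=
  ∀ m : ℕ, ZHom w (P.coeff m) (W + s * m)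

variable {w : σ → ℤ}

namespace ZHom

/-- `0` is graded of every weight. [folklore] -/
theorem zero (W : ℤ) : ZHom w (0 : Polynomial (MvPolynomial σ R)) W :=
  fun _ => isWeightedHomogeneous_zero R w _

/-- Constants: `C a` with `a` weighted homogeneous of weight `W`. [folklore] -/
theorem C {a : MvPolynomial σ R} {W : ℤ} (ha : IsWeightedHomogeneous w a W) :
    ZHom w (Polynomial.C a) W := by
  intro ι
  rw [Polynomial.coeff_C]
  split_ifs with h
  · subst h
    simpa using ha
  · exact isWeightedHomogeneous_zero R w _

/-- The variable `z` has weight `1`. [folklore] -/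
theorem X : ZHom w (Polynomial.X : Polynomial (MvPolynomial σ R)) 1 := by
  intro ι
  rw [Polynomial.coeff_X]
  split_ifs with h
  · subst h
    simpa using isWeightedHomogeneous_one R w
  · exact isWeightedHomogeneous_zero R w _

/-- `1` has weight `0`. [folklore] -/
theorem one : ZHom w (1 : Polynomial (MvPolynomial σ R)) 0 := by
  simpa using ZHom.C (w := w) (isWeightedHomogeneous_one R w)

/-- Integer casts have weight `0`. [folklore] -/
theorem intCast (n : ℤ) : ZHom w ((n : Polynomial (MvPolynomial σ R))) 0 := by
  rw [← Polynomial.C_eq_intCast, ← map_intCast (MvPolynomial.C : R →+* MvPolynomial σ R)]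
  exact ZHom.C (isWeightedHomogeneous_C w _)

/-- Natural-number casts have weight `0`. [folklore] -/
theorem natCast (n : ℕ) : ZHom w ((n : Polynomial (MvPolynomial σ R))) 0 := by
  simpa using ZHom.intCast (w := w) (R := R) (n : ℤ)

/-- Sums. [folklore] -/
theorem add {P Q : Polynomial (MvPolynomial σ R)} {W : ℤ} (hP : ZHom w P W) (hQ : ZHom w Q W) :
    ZHom w (P + Q) W := fun ι => by
  rw [Polynomial.coeff_add]
  exact (hP ι).add (hQ ι)

/-- Negation. [folklore] -/
theorem neg {P : Polynomial (MvPolynomial σ R)} {W : ℤ} (hP : ZHom w P W) : ZHom w (-P) W :=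
  fun ι => by
  rw [Polynomial.coeff_neg]
  exact (weightedHomogeneousSubmodule R w _).neg_mem (hP ι)

/-- Differences. [folklore] -/
theorem sub {P Q : Polynomial (MvPolynomial σ R)} {W : ℤ} (hP : ZHom w P W) (hQ : ZHom w Q W) :
    ZHom w (P - Q) W := by
  rw [sub_eq_add_neg]
  exact hP.add hQ.neg

/-- Finite sums. [folklore] -/
theorem sum {ι : Type*} (s : Finset ι) (f : ι → Polynomial (MvPolynomial σ R)) (W : ℤ)
    (h : ∀ i ∈ s, ZHom w (f i) W) : ZHom w (∑ i ∈ s, f i) W := by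
  classical
  induction s using Finset.induction_on with
  | empty => simpa using ZHom.zero (w := w) (R := R) W
  | insert a s ha ih =>
    rw [Finset.sum_insert ha]
    exact (h a (Finset.mem_insert_self a s)).add
      (ih fun i hi => h i (Finset.mem_insert_of_mem hi))

/-- Products: weights add. [folklore] -/
theorem mul {P Q : Polynomial (MvPolynomial σ R)} {W W' : ℤ} (hP : ZHom w P W) (hQ : ZHom w Q W') :
    ZHom w (P * Q) (W + W') := fun ι => by
  rw [Polynomial.coeff_mul]
  refine IsWeightedHomogeneous.sum _ _ _ fun x hx => ?_
  have hx' : (x.1 : ℤ) + x.2 = ι := by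
    rw [Finset.mem_antidiagonal] at hx
    exact_mod_cast hx
  have := (hP x.1).mul (hQ x.2)
  convert this using 1
  linear_combination hx'

/-- Finite products. [folklore] -/
theorem prod {ι : Type*} (s : Finset ι) (f : ι → Polynomial (MvPolynomial σ R)) (W : ι → ℤ)
    (h : ∀ i ∈ s, ZHom w (f i) (W i)) : ZHom w (∏ i ∈ s, f i) (∑ i ∈ s, W i) := by
  classical
  induction s using Finset.induction_on with
  | empty => simpa using ZHom.one (w := w) (R := R)
  | insert a s ha ih =>
    rw [Finset.prod_insert ha, Finset.sum_insert ha]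
    exact (h a (Finset.mem_insert_self a s)).mul
      (ih fun i hi => h i (Finset.mem_insert_of_mem hi))

/-- Powers. [folklore] -/
theorem pow {P : Polynomial (MvPolynomial σ R)} {W : ℤ} (hP : ZHom w P W) (n : ℕ) :
    ZHom w (P ^ n) (n * W) := by
  induction n with
  | zero => simpa using ZHom.one (w := w) (R := R)
  | succ n ih =>
    rw [pow_succ]
    convert ih.mul hP using 1
    push_cast
    ring

/-- A `ZHom` polynomial all of whose variable weights are positive vanishes in the coefficients
`zᶥ` with `ι > W`; in particular it is `0` if `W < 0`. [folklore] -/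
theorem coeff_eq_zero_of_lt {P : Polynomial (MvPolynomial σ R)} {W : ℤ} (hP : ZHom w P W)
    (hw : ∀ i, 0 ≤ w i) {ι : ℕ} (hι : W < ι) : P.coeff ι = 0 := by
  classical
  by_contra hne
  obtain ⟨m, hm⟩ := MvPolynomial.ne_zero_iff.mp hne
  have hdeg : Finsupp.weight w m = W - ι := hP ι hm
  have hnn : (0 : ℤ) ≤ Finsupp.weight w m := by
    rw [Finsupp.weight_apply]
    exact Finset.sum_nonneg fun i _ => by
      have := hw i
      positivity
  rw [hdeg] at hnn
  linarith

/-- Determinants: if the `(i, j)` entry is `ZHom` of weight `W₁ i + W₂ j`, the determinant is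
`ZHom` of weight `Σ W₁ + Σ W₂` (isobaric determinants; the mechanism of Kaltofen's Thm. 3/4
degree counts). [folklore] -/
theorem det {n : Type*} [Fintype n] [DecidableEq n]
    (M : Matrix n n (Polynomial (MvPolynomial σ R))) (W₁ W₂ : n → ℤ)
    (hM : ∀ i j, ZHom w (M i j) (W₁ i + W₂ j)) :
    ZHom w M.det (∑ i, W₁ i + ∑ j, W₂ j) := by
  rw [Matrix.det_apply']
  refine ZHom.sum _ _ _ fun π _ => ?_
  have hε : ZHom w ((Equiv.Perm.sign π : ℤ) : Polynomial (MvPolynomial σ R)) 0 := ZHom.intCast _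
  have hp := ZHom.prod Finset.univ (fun i => M (π i) i) (fun i => W₁ (π i) + W₂ i)
    (fun i _ => hM (π i) i)
  have := hε.mul hp
  convert this using 1
  rw [zero_add, Finset.sum_add_distrib, Equiv.sum_comp π W₁]

end ZHom

namespace YZHom

variable {s : ℤ}

/-- `0`. [folklore] -/
theorem zero (W : ℤ) : YZHom w s (0 : Polynomial (Polynomial (MvPolynomial σ R))) W :=
  fun m => by simpa using ZHom.zero (w := w) (R := R) (W + s * m)

/-- Constants: `C P` with `P` `z`-graded of weight `W`. [folklore] -/
theorem C {P : Polynomial (MvPolynomial σ R)} {W : ℤ} (hP : ZHom w P W) :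
    YZHom w s (Polynomial.C P) W := by
  intro m
  rw [Polynomial.coeff_C]
  split_ifs with h
  · subst h
    simpa using hP
  · exact ZHom.zero _

/-- The variable `y` has weight `-s`. [folklore] -/
theorem X : YZHom w s (Polynomial.X : Polynomial (Polynomial (MvPolynomial σ R))) (-s) := by
  intro m
  rw [Polynomial.coeff_X]
  split_ifs with h
  · subst h
    simpa using ZHom.one (w := w) (R := R)
  · exact ZHom.zero _

/-- `1`. [folklore] -/
theorem one : YZHom w s (1 : Polynomial (Polynomial (MvPolynomial σ R))) 0 := by
  simpa using YZHom.C (s := s) (ZHom.one (w := w) (R := R))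

/-- Sums. [folklore] -/
theorem add {P Q : Polynomial (Polynomial (MvPolynomial σ R))} {W : ℤ} (hP : YZHom w s P W)
    (hQ : YZHom w s Q W) : YZHom w s (P + Q) W := fun m => by
  rw [Polynomial.coeff_add]
  exact (hP m).add (hQ m)

/-- Negation. [folklore] -/
theorem neg {P : Polynomial (Polynomial (MvPolynomial σ R))} {W : ℤ} (hP : YZHom w s P W) :
    YZHom w s (-P) W := fun m => by
  rw [Polynomial.coeff_neg]
  exact (hP m).neg

/-- Differences. [folklore] -/
theorem sub {P Q : Polynomial (Polynomial (MvPolynomial σ R))} {W : ℤ} (hP : YZHom w s P W)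
    (hQ : YZHom w s Q W) : YZHom w s (P - Q) W := fun m => by
  rw [Polynomial.coeff_sub]
  exact (hP m).sub (hQ m)

/-- Finite sums. [folklore] -/
theorem sum {ι : Type*} (S : Finset ι) (f : ι → Polynomial (Polynomial (MvPolynomial σ R)))
    (W : ℤ) (h : ∀ i ∈ S, YZHom w s (f i) W) : YZHom w s (∑ i ∈ S, f i) W := by
  classical
  induction S using Finset.induction_on with
  | empty => simpa using YZHom.zero (w := w) (R := R) (s := s) W
  | insert a S ha ih =>
    rw [Finset.sum_insert ha]
    exact (h a (Finset.mem_insert_self a S)).add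
      (ih fun i hi => h i (Finset.mem_insert_of_mem hi))

/-- Products: weights add. [folklore] -/
theorem mul {P Q : Polynomial (Polynomial (MvPolynomial σ R))} {W W' : ℤ} (hP : YZHom w s P W)
    (hQ : YZHom w s Q W') : YZHom w s (P * Q) (W + W') := fun m => by
  rw [Polynomial.coeff_mul]
  refine ZHom.sum _ _ _ fun x hx => ?_
  have hx' : (x.1 : ℤ) + x.2 = m := by
    rw [Finset.mem_antidiagonal] at hx
    exact_mod_cast hx
  have := (hP x.1).mul (hQ x.2)
  convert this using 1
  linear_combination (-s) * hx'

/-- Finite products. [folklore] -/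
theorem prod {ι : Type*} (S : Finset ι) (f : ι → Polynomial (Polynomial (MvPolynomial σ R)))
    (W : ι → ℤ) (h : ∀ i ∈ S, YZHom w s (f i) (W i)) :
    YZHom w s (∏ i ∈ S, f i) (∑ i ∈ S, W i) := by
  classical
  induction S using Finset.induction_on with
  | empty => simpa using YZHom.one (w := w) (R := R) (s := s)
  | insert a S ha ih =>
    rw [Finset.prod_insert ha, Finset.sum_insert ha]
    exact (h a (Finset.mem_insert_self a S)).mul
      (ih fun i hi => h i (Finset.mem_insert_of_mem hi))

/-- Powers. [folklore] -/
theorem pow {P : Polynomial (Polynomial (MvPolynomial σ R))} {W : ℤ} (hP : YZHom w s P W)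
    (n : ℕ) : YZHom w s (P ^ n) (n * W) := by
  induction n with
  | zero => simpa using YZHom.one (w := w) (R := R) (s := s)
  | succ n ih =>
    rw [pow_succ]
    convert ih.mul hP using 1
    push_cast
    ring

/-- Monomials `C P * X^j`. [folklore] -/
theorem C_mul_X_pow {P : Polynomial (MvPolynomial σ R)} {W : ℤ} (hP : ZHom w P W) (j : ℕ) :
    YZHom w s (Polynomial.C P * Polynomial.X ^ j) (W - s * j) := by
  have := (YZHom.C (s := s) hP).mul ((YZHom.X (w := w) (R := R) (s := s)).pow j)
  convert this using 1
  ring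

/-- Truncation preserves the grading. [folklore] -/
theorem truncY {P : Polynomial (Polynomial (MvPolynomial σ R))} {W : ℤ} (hP : YZHom w s P W)
    (m : ℕ) : YZHom w s (truncY m P) W := by
  intro k
  rw [coeff_truncY]
  split_ifs
  · exact hP k
  · exact ZHom.zero _

/-- A coefficientwise map preserving `ZHom` preserves `YZHom`. [folklore] -/
theorem mapCoeffs {L : Polynomial (MvPolynomial σ R) →ₗ[MvPolynomial σ R] Polynomial (MvPolynomial σ R)}
    (hL : ∀ (Q : Polynomial (MvPolynomial σ R)) (V : ℤ), ZHom w Q V → ZHom w (L Q) V)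
    {P : Polynomial (Polynomial (MvPolynomial σ R))} {W : ℤ} (hP : YZHom w s P W) :
    YZHom w s (mapCoeffs L P) W := fun m => by
  rw [coeff_mapCoeffs]
  exact hL _ _ (hP m)

end YZHom

end Graded

/-! ### Degree and norm of a determinant -/

section Det

variable {S : Type*} [CommRing S] {n : Type*} [Fintype n] [DecidableEq n]

/-- If every entry of a matrix over `S[X]` has degree `≤ B`, its determinant has degree
`≤ |n| · B`. [folklore] -/
theorem natDegree_det_le_of_le (M : Matrix n n S[X]) (B : ℕ) (hM : ∀ i j, (M i j).natDegree ≤ B) :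
    M.det.natDegree ≤ Fintype.card n * B := by
  rw [Matrix.det_apply']
  refine Polynomial.natDegree_sum_le_of_forall_le _ _ fun π _ => ?_
  refine (Polynomial.natDegree_mul_le).trans ?_
  have hε : ((Equiv.Perm.sign π : ℤ) : S[X]).natDegree = 0 := by
    rw [← Polynomial.C_eq_intCast, natDegree_C]
  rw [hε, zero_add]
  refine (Polynomial.natDegree_prod_le _ _).trans ?_
  calc ∑ i, (M (π i) i).natDegree ≤ ∑ _i : n, B := Finset.sum_le_sum fun i _ => hM _ _
    _ = Fintype.card n * B := by rw [Finset.sum_const, Finset.card_univ, smul_eq_mul]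

/-- If `q (M i j) ≤ B j` for a ring seminorm `q` with `q 1 ≤ 1` and `B ≥ 0`, then
`q (det M) ≤ |n|! · ∏ B j` (Hadamard-free "minor expansion" bound, Kaltofen Thm. 3/4). [folklore] -/
theorem seminorm_det_le (q : RingSeminorm S) (hq : q 1 ≤ 1) (M : Matrix n n S) (B : n → ℝ)
    (hB : ∀ j, 0 ≤ B j) (hM : ∀ i j, q (M i j) ≤ B j) :
    q M.det ≤ (Fintype.card n).factorial * ∏ j, B j := by
  rw [Matrix.det_apply']
  have hterm : ∀ π : Equiv.Perm n,
      q (((Equiv.Perm.sign π : ℤ) : S) * ∏ i, M (π i) i) ≤ ∏ j, B j := by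
    intro π
    refine (map_mul_le_mul q _ _).trans ?_
    have hε : q ((Equiv.Perm.sign π : ℤ) : S) ≤ 1 := by
      rcases Int.units_eq_one_or (Equiv.Perm.sign π) with h | h
      · rw [h]; simpa using hq
      · rw [h, Units.val_neg, Units.val_one, Int.cast_neg, Int.cast_one, map_neg_eq_map]
        exact hq
    have hprod : q (∏ i, M (π i) i) ≤ ∏ j, B j := by
      have key : ∀ (T : Finset n), q (∏ i ∈ T, M (π i) i) ≤ ∏ i ∈ T, B i := by
        intro T
        induction T using Finset.induction_on with
        | empty => simpa using hq
        | insert a T ha ih =>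
          rw [Finset.prod_insert ha, Finset.prod_insert ha]
          exact (map_mul_le_mul q _ _).trans
            (mul_le_mul (hM _ _) ih (apply_nonneg q _) (hB a))
      exact key Finset.univ
    calc q ((Equiv.Perm.sign π : ℤ) : S) * q (∏ i, M (π i) i) ≤ 1 * ∏ j, B j :=
          mul_le_mul hε hprod (apply_nonneg q _) zero_le_one
      _ = ∏ j, B j := one_mul _
  have hsum : ∀ (T : Finset (Equiv.Perm n)),
      q (∑ π ∈ T, ((Equiv.Perm.sign π : ℤ) : S) * ∏ i, M (π i) i) ≤ T.card * ∏ j, B j := by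
    intro T
    induction T using Finset.induction_on with
    | empty => simp
    | insert a T ha ih =>
      rw [Finset.sum_insert ha, Finset.card_insert_of_notMem ha]
      refine (map_add_le_add q _ _).trans ?_
      push_cast
      linarith [hterm a]
  have := hsum Finset.univ
  rwa [Finset.card_univ, Fintype.card_perm] at this

end Det

end Literature.RingTheory.MvPolynomial.NoetherForms
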